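/-
Copyright: lit-balaban Phase-2 proof seat p29 (gen 31).  Statement-level skeleton of a published paper; no proof claims beyond what the
kernel checks below.
-/
import Literature.MathematicalPhysics.QuantumFieldTheory.BalabanImbrieJaffe1984to88.BIJ88Close231RegularRegionCwt
import Literature.MathematicalPhysics.QuantumFieldTheory.BalabanImbrieJaffe1984to88.BIJ88LocDeriv230SmallFieldTorus

/-!
# `BalabanImbrieJaffe1984to88.BIJ88LocHolder231RegularRegion` — T. Bałaban, J. Imbrie, A. Jaffe, *Effective action and cluster properties of
the abelian Higgs model*, Commun. Math. Phys. **114** (1988) 257–315 [BalabanImbrieJaffe1988], Sect. 2 p. 263 [PDF 7], (2.31) and the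
sentence after (2.33): *"Bounds analogous to (2.30), (2.31) hold for covariant derivatives and Hölder derivatives of G_{k,loc}(u) of order less
than two"* — **THE HÖLDER MEMBER OF ORDER `θ ≤ 1` OF (2.31) FOR A GENERAL BIG-BLOCK REGION `Ω ⊂ T_η` AT A NON-FLAT BACKGROUND `u = e^{ieεA}`
WITH `A` (2.23)-REGULAR ON `Ω` ONLY, FOR THE PRINTED LOCALIZATION DATA WITH BIG-BLOCK CUBES** (r18's `cubeFamB` = the big-block hulls of gen
26's torus cubes, the weights `λ_α` of (2.27), p13's cut-off `ζ″` of (2.29)): the gauge-covariant Hölder quotient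
`(L^k/|x₁ − x₂|_T)^θ·|u(Γ_{x₁x₂})ψ(x₂) − ψ(x₁)|` of the DIFFERENCE `ψ = G_{k,loc}(u)f − G_k(Ω,u)f`, the parallel transport `u(Γ)` taken along a
bond chain `Γ` AT THE NON-FLAT FIELD, obeys r18's (2.31)-type derivative bracket times `(L^kε)²·e^{−(δ₀/2)D/L^k}‖f‖_∞` for every pair of points
deep inside the reference box `Ω₀` joined by an admissible contour, every `0 ≤ θ ≤ 1` — gen 29's `BIJ88LocHolder231RegularTorus` (the case
`Ω = T_η`, `A` regular on the whole torus) with the comparison propagator `G_k(T_η,u)` replaced by the Neumann propagator `G_k(Ω,u)` of ANY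
union `Ω` of big blocks containing the big-block hull of `Ω₀`, and the regularity of `A` assumed ON `Ω` ALONE (print: *"for (2.31) we assume
smoothness throughout the subset Ω ⊂ T_η"*, *"(2.31) for dist(x, Ω^c) ≧ O(r(e_k))"*).

statement-level skeleton of published theorems with citation tags; proofs where landed; nothing here is a claim about the Yang–Mills mass gap

PDF held: `paper:balaban1988-cmp114-bij-abelian-higgs-effective-action` (journal page = PDF page + 256); p. 263 [PDF 7] re-read this session on
the materialised text layer (`lit read`); [6] = [Balaban1983RegularityDecay] p. 573 (*"Γ_{x,x′} a shortest contour connecting these points"*,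
the transport `U(A(Γ_{x,x′}))` of (1.9)); [BalabanImbrieJaffe1985] p. 326 (*"also satisfy the regularity and decay estimates of [7]"* — the
(2.23)-regular form of *"smooth"*).

CITATION HEADER (lean-in-tree rule).  Part of the lit-balaban TYPED SKELETON (HOME `run/shared/lean/pub/lit-balaban/`), PHASE-2 proof seat
p29 gen 31 (unit `lit-balaban-p29-g31`; free-target protocol G.5-34(d), TAKING #1 line HOME/STATUS.md 2026-08-23T09:38:53Z, window honoured;
the row owner r18's coverage matrix `HOME/lit-balaban-r18/C2S14-CLOSURE.md` §6 (v1.17) lists this cell — Hölder `θ ≤ 1`, general big-block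
`Ω`, regular background — as *"not filed as a named regular-u theorem"*).  Rows **C2.Eq2.31** / **C2.Claim@263** of
`HOME/lit-balaban-r18/ROWS-C2.md` (owner r18; the abstract hence-step is p08's `BIJ88HolderDecay230`, unchanged; heads unchanged — this is a
LOCATED member).  Kind: theorems only (no definition, no `Prop`-valued fact; r18's / gen 26–29's / p13's / T4's declarations used BY NAME,
nothing restated): r18 gen 25 `BIJ88Close231RegularRegionCwt` (**`opClose231_regular_region_cwt`** — the value member of (2.31) for the
region; **`deriv231_regular_region_of_lipschitz`** — the covariant-derivative member for the region with a generic Lipschitz cut-off; both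
resting on r01's `BIJ85NeumannPropagatorRegularClose` / `…Deriv` region providers of [6] (1.10)/(1.11)–(1.12)), r18 gen 24
`BIJ88Close231RegularTorusCwt` (`bbHull`, `cubeFamB`, `rowMargin`), gen 26 `BIJ88LocWeights227Torus` (`labels`, `lamFam`, `rowHyp_iii`,
`cutoff_eq_zero_of_le`), gen 27 `BIJ88LocDeriv230FlatTorus` (`exists_abs_cutoff_sub_le`), gen 28 `BIJ88LocDeriv230SmallFieldTorus`
(`norm_transport_sub_le_sum_covD`, `exists_admissible_contour`, `cutoff_hyps`), p13 `BIJ88Cutoffs21` (`cutoff`), p31 (`gBox`, `gLocT`, `cubeT`, `boxCoord`), p38's metric `B5Ineq137Torus.T`, T4's `chainHol`/`Joins`.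
NOTE (why not an instance of gen 30's hypothesis form): gen 30's `BIJ88Loc231RegionOfInputs.holder231_region_of_inputs` asks its inputs
(H1)/(H2) for the `L^k`-cubes `cubeT (L^k) c′ (L^kM′)` of the data `cubeFam`; at the regular background the [6]-providers of record (r01) are
stated for unions of BIG blocks (side `L^kL^s`), which those cubes are not — hence r18's big-block variant `cubeFamB` of the data and, here, gen
29's telescoping argument re-run with `T^{(0)} ↦ Ω` rather than an instantiation.

THE PRINTED TEXT (verbatim, p. 263, print order).  *"|(G_{k,loc}(u)f − G_k(Ω,u)f)(x)| ≦ e^{−cr(e_k)}e^{−c dist(suppt f,x)}‖f‖_∞, (2.31) for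
dist(x,Ω^c) ≧ O(r(e_k)). [Each G_k(□_α,u) is close to G_k(Ω,u) for the relevant x₁, x₂, therefore the convex combination and G_{k,loc} are
close also.] We assume that u is smooth in the □_α's entering the sum in (2.27); for (2.31) we assume smoothness throughout the subset
Ω ⊂ T_η. … Bounds analogous to (2.30), (2.31) hold for covariant derivatives and Hölder derivatives of G_{k,loc}(u) of order less than two."*
*"Smooth"* `u` ON `Ω` is taken in the (2.23)-regular form of [BalabanImbrieJaffe1985] p. 326 / [6]: `u = e^{ieεA}` with
`L^kε|e|/e_k·|∂A|(z) ≦ c·e_k^{β−1}/L^k` FOR `z ∈ Ω`, `0 < e_k ≦ e₁` (r18's `BIJ88Close231RegularRegionCwt`, verbatim).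

THE MECHANISM (ours, declared — gen 29's telescoping with r18's regular-background REGION members as the inputs).  NEAR PAIRS
(`|x₁ − x₂|_T ≤ L^k`): along a bond chain `Γ = (x₁ = s_0, …, s_n = x₂)` the transported difference telescopes bond by bond AT THE NON-FLAT
`u` (gen 28's `norm_transport_sub_le_sum_covD`: `‖u(Γ)ψ(s_n) − ψ(s_0)‖ ≤ ε·Σ_m‖(D_uψ)(c_m)‖`, `|u| = 1`), each bond costing `ε` times r18's
covariant-derivative analogue of (2.31) for the region (`deriv231_regular_region_of_lipschitz`, instantiated at p13's cut-off of record —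
`0 ≤ ζ″ ≤ 1`, `ζ″ = 0` beyond `R₀`, `= 1` within `R₁`, one-step modulus `≤ K/(R₀ − R₁)` by gen 28's `cutoff_hyps` with the Lipschitz constant `K` of
`exists_abs_cutoff_sub_le`; `D_uψ = D_u(G_{k,loc}f) − D_u(G_k(Ω)f)` by additivity) at the support distance `≥ D − |x₁ − x₂|_T ≥ D − L^k` seen from the
contour; the weight `(L^k/T)^θ ≤ L^k/T` (`θ ≤ 1`) against the `≤ (d+1)T` steps leaves `(d+1)·L^kε`.  FAR PAIRS (`|x₁ − x₂|_T > L^k`): weight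
`≤ 1`, two value members (`opClose231_regular_region_cwt`), `|u(Γ)| = 1`.  Both inputs decay at the SAME explicit rate `δ₀ = 1/(8L^s)`, so the
bracket of the radii is r18's §4 bracket verbatim (the value member's `e^{−2δ₀R/L^k}`, `e^{−(δ₀/2)R₁/L^k}` are dominated by
`e^{−δ₀(2R−1)/L^k}`, `e^{−(δ₀/2)(R₁−1)/L^k}`).  ADMISSIBLE CONTOURS (all sites in `Ω₀` at chart depth `≥ R₀ + R`, within `|x₁ − x₂|_T` of
`x₁`, `≤ (d+1)|x₁ − x₂|_T` steps) exist between deep points at torus distance `≤ R₀ + R`: gen 28's chart staircase `exists_admissible_contour`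
(§3); they never leave `Ω₀ ⊆ Ω`.

WHAT IS PROVED (theorems only; 0 `sorry`; standard axioms).
* §1 (private) `rpow_le_self_of_one_le`, `covD_sub`.
* §2 **`holder231_regular_region_cwt`** — `∃ s₀ ∀ s ≥ s₀ ∃ c₀ e₁ > 0` (from `(d, L, a, e, c, β, s)` only) such that on every torus of the
  series (`P.d = d+1`, `P.L = L ≥ 2`), at every level `1 ≤ k ≤ K` with `k + s ≤ m + K`, `3L^kL^s ≤ |T^{(0)}|`, for EVERY union `Ω` of big
  blocks (side `L^kL^s`), every `A` (2.23)-regular ON `Ω` (`0 < e_k ≤ e₁`), `u = e^{ieεA}` (`expGauge P e A`), every reference no-wrap box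
  `Ω₀ = c·L^k + Π_i[0, L^kM₀_i)` shorter than the torus with torus gap `≥ R` and `bbHull (L^kL^s) Ω₀ ⊆ Ω`, grid spacing `s_g ≥ 1`, half-width
  `W ≥ 2s_g/3 + R₀/2 + R`, radii `R > rowMargin + 1`, `0 ≤ R₁ < R₀`, every `0 ≤ θ ≤ 1`, every admissible bond chain `Γ` from `x₁` to `x₂`,
  every `f` with `‖f‖_∞ ≤ F` supported at sup-torus distance `≥ D ≥ 0` from both points:
  `(L^k/|x₁ − x₂|_T)^θ·‖u(Γ)ψ(x₂) − ψ(x₁)‖ ≤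
   (L^kε)²·c₀·[m(1 + L^k((R₀−R₁)⁻¹ + s_g⁻¹))e^{−δ₀(2R−1)/L^k} + (1 + L^k(R₀−R₁)⁻¹)e^{−(δ₀/2)(R₁−1)/L^k}]·e^{−(δ₀/2)D/L^k}·F`, `δ₀ = 1/(8L^s)`,
  `m = (⌊(L^k − 1 + R₀)/s_g⌋ + 3)^{d+1}`, `ψ = G_{k,loc}(u)f − G_k(Ω,u)f` — at the printed radii (`R, R₁ ~ r(e_k)L^k ≫ rowMargin`;
  `s_g, R₀ − R₁ ≫ L^k`) the bracket is print's `e^{−cr(e_k)}`.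
* §3 **`exists_contour_holder231_regular_region_cwt`** — [6]'s shortest-contour ∃-form: for `x₁, x₂ ∈ Ω₀` at chart depth `≥ R₀ + R` with
  `|x₁ − x₂|_T ≤ R₀ + R` there is a bond chain of `≤ (d+1)|x₁ − x₂|_T` steps along which §2's bound holds for every `θ`, `f`.
* §4 (v1.1) **`holder231_regular_region_cwt_nonvacuous`** — the hypotheses of §3 (hence of §2) are JOINTLY SATISFIABLE WITH A PROPER REGION
  AND TWO DISTINCT DEEP POINTS, thresholds included: for every `(a, e, c, β)` there are `s` (the threshold itself), `c₀, e₁ > 0` and — chosen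
  after them — r18's §5 `Setup` torus `ℤ/(2·3^{s+7})` (`d = 1`, `L = 3`, `m = s + 6`, `K = 1`), `k = 1`, `Ω₀ = [0, 3^{s+5})`,
  `Ω = bbHull (3·3^s) Ω₀` (a union of big blocks that MISSES the site `3^{s+5}`, so `Ω ≠ T^{(0)}`), `A = 0`, `s_g = 1`, `R = rowMargin + 2`,
  `R₀ = 1`, `R₁ = 0`, `W = rowMargin + 4`, the neighbouring sites `x₁ ≡ rowMargin + 3`, `x₂ = x₁ + e_0` (distinct, both at chart depth
  `≥ R₀ + R`, `|x₁ − x₂|_T ≤ 1 ≤ R₀ + R`), meeting every displayed hypothesis; consequently there IS an admissible contour from `x₁` to `x₂`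
  along which the Hölder bound holds for every `0 ≤ θ ≤ 1` and every `f` (r18's `opClose231_regular_region_cwt_nonvacuous` pattern).
HONEST SCOPE / DIVERGENCE.  (i) `Ω` must be a union of big blocks of side `L^kL^s` (r01's region hypothesis) CONTAINING `bbHull (L^kL^s) Ω₀`
— print's *"dist(x, Ω^c) ≧ O(r(e_k))"* is rendered, as in r18's region members, by reading the localization in a reference chart box `Ω₀`
whose big-block hull lies in `Ω`, at points of chart depth `≥ R₀ + R`; `u` is EXACTLY `e^{ieεA}` with `A` (2.23)-regular ON `Ω` (no change of
gauge; bondwise/plaquette-small `u` beyond regular `A` is the small-plaquette lane — gen 30's `BIJ88Loc231SmallPlaquetteRegion`).  (ii) ORDER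
`θ ≤ 1` ONLY (quotients of the VALUES of `ψ`); the order-`1 + θ` member for the region is r18 gen 25's
`BIJ88LocDerivHolder231RegularRegion`; the value and order-`1` members are r18's `BIJ88Close231RegularRegionCwt` §3/§4.  (iii) THE CUBES ARE
r18's BIG-BLOCK HULLS `cubeFamB`; the `G_{k,loc}(u)` is the (2.28) object of THAT family.  (iv) The transport is T4's ordered holonomy
`chainHol` of an arbitrary admissible chain (print: a shortest contour; every admissible chain gives the same bound); far pairs need no
admissibility but the statement keeps one shape.  (v) Constants: `s₀, c₀, e₁` existential (r18's/r01's thresholds;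
`c₀ = max((d+1)e^{δ₀/2}c₁, 2c₂)` with `c₁` r18's derivative constant at `K₁ = K`), `δ₀` explicit; §4's instance shows the hypotheses jointly met (it does not evaluate `s₀, c₀, e₁`).  (vi) The case
`Ω = T^{(0)}` is gen 29's `holder231_regular_torus_cwt` (not re-derived here).  (vii) `set_option maxHeartbeats 400000` on §2 (elaboration
budget only).  Imports: r18 `BIJ88Close231RegularRegionCwt` (v1.1; → `BIJ88Close231RegularTorusCwt` → r01 `BIJ85NeumannPropagatorRegularClose`
/ `…Deriv`, p31, gen 26/27), gen 28 `BIJ88LocDeriv230SmallFieldTorus` (→ T4 `T4TreeGaugeTransform`, p34).  Literature + Mathlib only.  Unit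
`lit-balaban-p29` (literature-prover-lit-balaban-p29-g31-0), 2026-08-23; v1.1 (same day, same seat) = v1 (p360698) VERBATIM + §4 (append-only;
no declaration of v1 touched).  NOT summit progress.
-/

open scoped BigOperators Matrix ComplexConjugate
open Finset Matrix

namespace Literature.MathematicalPhysics.QuantumFieldTheory.BalabanImbrieJaffe1984to88.BIJ88LocHolder231RegularRegion

open Literature.MathematicalPhysics.QuantumFieldTheory.Balaban1983to89
open BIJ88Sect3Statements (U1 toC cfg covD norm_toC)
open BIJ85BlockAveragesTorus BIJ85BlockAveragesTorusK
open BIJ88NeumannPropagator227Torus (gBox)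
open BIJ88DeltaLoc234Torus (gLocT)
open BIJ88NeumannPropagatorFlatDecayCube
open BIJ88Cutoffs21 (cutoff)
open BIJ88LocWeights227Torus
open BIJ85CovariantHiggsDictionary (expGauge)
open BIJ88Close231RegularTorusCwt (bbHull cubeFamB rowMargin)
open BIJ88Close231RegularRegionCwt (opClose231_regular_region_cwt deriv231_regular_region_of_lipschitz)
open BIJ88LocDeriv230FlatTorus (exists_abs_cutoff_sub_le)
open BIJ88LocDeriv230SmallFieldTorus (norm_transport_sub_le_sum_covD exists_admissible_contour cutoff_hyps)
open T4TreeGaugeFixing (Joins)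
open T4TreeGaugeTransform (chainHol)

noncomputable section

variable {d : ℕ} {P : Params}

/-! ## §1 Kernel lemmas -/

/-- kernel: for `1 ≤ t` and `θ ≤ 1`, `t^θ ≤ t`. [folklore] -/
private theorem rpow_le_self_of_one_le {t θ : ℝ} (ht : 1 ≤ t) (hθ : θ ≤ 1) : t ^ θ ≤ t := by
  have h := Real.rpow_le_rpow_of_exponent_le ht hθ
  rwa [Real.rpow_one] at h

/-- kernel: the covariant derivative is additive in the function: `D_u(φ − ψ) = D_uφ − D_uψ`. [cite: BalabanImbrieJaffe1988, (3.3) p.265] -/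
private theorem covD_sub {j : ℕ} (c' : ℝ) (u : PBond P j → ℂ) (φ ψ : Balaban1983to89.Site P j → ℂ) (b : PBond P j) :
    covD c' u (φ - ψ) b = covD c' u φ b - covD c' u ψ b := by
  simp only [covD, Pi.sub_apply]; ring

/-! ## §2 The Hölder member of order `θ ≤ 1` of (2.31) for a general big-block region `Ω`, `A` regular on `Ω`, along admissible contours -/

section Holder

set_option maxHeartbeats 400000 in
/-- **THE HÖLDER MEMBER OF ORDER `θ ≤ 1` OF (2.31) FOR A GENERAL BIG-BLOCK REGION `Ω ⊇ bbHull(Ω₀)` AT A NON-FLAT BACKGROUND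
`u = e^{ieεA}` WITH `A` (2.23)-REGULAR ON `Ω` ONLY, FOR THE PRINTED LOCALIZATION DATA WITH BIG-BLOCK CUBES, ALONG EVERY ADMISSIBLE
CONTOUR** (p. 263: *"|(G_{k,loc}(u)f − G_k(Ω,u)f)(x)| ≦ e^{−cr(e_k)}e^{−c dist(suppt f,x)}‖f‖_∞ (2.31) for dist(x, Ω^c) ≧ O(r(e_k)) … for
(2.31) we assume smoothness throughout the subset Ω ⊂ T_η … Bounds analogous to (2.30), (2.31) hold for covariant derivatives and Hölder
derivatives of G_{k,loc}(u) of order less than two"*; [6] p. 573 (1.9): the transport `U(A(Γ_{x,x′}))` along *"a shortest contour connecting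
these points"*).  `∃ s₀ ∀ s ≥ s₀ ∃ c₀ e₁ > 0` (from `(d, L, a, e, c, β, s)` only) such that on every torus of the series (`P.d = d+1`,
`P.L = L ≥ 2`), at every level `1 ≤ k ≤ K` with `k + s ≤ m + K`, `3L^kL^s ≤ |T^{(0)}|`, for EVERY union `Ω` of big blocks (side `L^kL^s`),
every real bond field `A` that is (2.23)-regular ON `Ω` (`L^kε|e|/e_k·|∂A|(z) ≤ c·e_k^{β−1}/L^k` for `z ∈ Ω`, `0 < e_k ≤ e₁`), every reference
no-wrap box `Ω₀ = c·L^k + Π_i[0, L^kM₀_i)` shorter than the torus with torus gap `≥ R` and `bbHull (L^kL^s) Ω₀ ⊆ Ω`, grid spacing `s_g ≥ 1`,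
half-width `W ≥ 2s_g/3 + R₀/2 + R`, radii `R > rowMargin + 1`, `0 ≤ R₁ < R₀`, EVERY exponent `0 ≤ θ ≤ 1`, every pair `x₁, x₂` joined by a
bond chain `Γ = (x₁ = s_0, …, s_n = x₂)` of `n ≤ (d+1)|x₁ − x₂|_T` steps all of whose sites lie in `Ω₀` at chart depth `≥ R₀ + R` and within
sup-torus distance `|x₁ − x₂|_T` of `x₁` (§3: the chart staircase is such a contour for near deep pairs), and every `f` with `‖f‖_∞ ≤ F`
supported at sup-torus distance `≥ D ≥ 0` from `x₁` and from `x₂`: with `ψ = G_{k,loc}(u)f − G_k(Ω,u)f`,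
`(L^k/|x₁ − x₂|_T)^θ·‖u(Γ)ψ(x₂) − ψ(x₁)‖ ≤
 (L^kε)²·c₀·[m(1 + L^k((R₀−R₁)⁻¹ + s_g⁻¹))e^{−δ₀(2R−1)/L^k} + (1 + L^k(R₀−R₁)⁻¹)e^{−(δ₀/2)(R₁−1)/L^k}]·e^{−(δ₀/2)D/L^k}·F`, `δ₀ = 1/(8L^s)`,
`m = (⌊(L^k−1+R₀)/s_g⌋+3)^{d+1}`, `u(Γ) = Π_m u(c_m)^{±1}` (T4's `chainHol`) — NEAR PAIRS (`|x₁ − x₂|_T ≤ L^k`): r18's covariant-derivative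
analogue of (2.31) for the region (`deriv231_regular_region_of_lipschitz`, at p13's cut-off of record: `|ζ″| ≤ 1`, `ζ″ = 0` beyond `R₀`,
`= 1` within `R₁`, one-step modulus `K/(R₀ − R₁)` with the Lipschitz constant `K` of `exists_abs_cutoff_sub_le`; for `D_uψ` by additivity)
telescoped bond by bond along `Γ` at the non-flat `u` (p29's `norm_transport_sub_le_sum_covD`), `(L^k/T)^θ·(d+1)T·ε ≤ (d+1)L^kε`, support
distance `≥ D − L^k` from the contour; FAR PAIRS: two value members (`opClose231_regular_region_cwt`), `|u(Γ)| = 1`; both inputs at the same rate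
`δ₀ = 1/(8L^s)`, so the bracket is r18's §4 bracket.  The case `Ω = T^{(0)}` is gen 29's `BIJ88LocHolder231RegularTorus.holder231_regular_torus_cwt`.
[cite: BalabanImbrieJaffe1988, (2.31) p.263] [cite: BalabanImbrieJaffe1985, p.326 «also satisfy the regularity and decay estimates of [7]»] -/
theorem holder231_regular_region_cwt (d L : ℕ) (hL : 2 ≤ L) {a : ℝ} (ha : 0 < a) (e creg β : ℝ) (hcreg : 0 ≤ creg) (hβ : 0 < β) :
    ∃ s₀ : ℕ, ∀ s : ℕ, s₀ ≤ s → ∃ c₀ e₁ : ℝ, 0 < c₀ ∧ 0 < e₁ ∧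
      ∀ (P : Params) (hPd : P.d = d + 1), P.L = L → ∀ (k : ℕ), 1 ≤ k → k ≤ P.K → k + s ≤ P.m + P.K →
      3 * (L ^ k * L ^ s) ≤ P.sitesPerDir 0 →
      ∀ (Ω : Finset (Balaban1983to89.Site P 0)),
        (∀ z z' : Balaban1983to89.Site P 0, (∀ μ, (z μ).val / (L ^ k * L ^ s) = (z' μ).val / (L ^ k * L ^ s)) → (z ∈ Ω ↔ z' ∈ Ω)) →
      ∀ (A : PBond P 0 → ℝ) (ec : ℝ), 0 < ec → ec ≤ e₁ →
      (∀ z ∈ Ω, ∀ (μ ν : Fin P.d),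
          P.spacing k * |e| / ec * |A ⟨z.shift μ, ν⟩ - A ⟨z, ν⟩| ≤ creg * ec ^ (β - 1) / (L : ℝ) ^ k) →
      ∀ (c M0 : Fin (d + 1) → ℕ), (∀ i, c i * P.L ^ k + P.L ^ k * M0 i ≤ P.sitesPerDir 0) → (∀ i, P.L ^ k * M0 i < P.sitesPerDir 0) →
        bbHull (L ^ k * L ^ s) (cubeT hPd (P.L ^ k) c fun i => P.L ^ k * M0 i) ⊆ Ω →
      ∀ (sg W : ℕ), 1 ≤ sg → ∀ (R R₀ R₁ : ℝ), ((rowMargin L (d + 1) k s : ℕ) : ℝ) + 1 < R → 0 ≤ R₁ → R₁ < R₀ →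
        2 * (sg : ℝ) / 3 + R₀ / 2 + R ≤ W → (∀ i, ((P.L ^ k * M0 i : ℕ) : ℝ) + R ≤ P.sitesPerDir 0) →
      ∀ (θ : ℝ), 0 ≤ θ → θ ≤ 1 →
      ∀ (x₁ x₂ : Balaban1983to89.Site P 0) (n : ℕ) (sq : ℕ → Balaban1983to89.Site P 0) (cb : ℕ → PBond P 0),
        sq 0 = x₁ → sq n = x₂ → (∀ m < n, Joins (cb m) (sq m) (sq (m + 1))) →
        (n : ℝ) ≤ ((d : ℝ) + 1) * B5Ineq137Torus.T P 0 x₁ x₂ →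
        (∀ m ≤ n, sq m ∈ (cubeT hPd (P.L ^ k) c fun i => P.L ^ k * M0 i) ∧
          (∀ i, R₀ + R ≤ (boxCoord hPd (P.L ^ k) c (sq m) i : ℝ) ∧
            (boxCoord hPd (P.L ^ k) c (sq m) i : ℝ) + (R₀ + R) ≤ (P.L ^ k * M0 i : ℕ) - 1) ∧
          B5Ineq137Torus.T P 0 x₁ (sq m) ≤ B5Ineq137Torus.T P 0 x₁ x₂) →
      ∀ (f : Balaban1983to89.Site P 0 → ℂ) (F D : ℝ), (∀ y, ‖f y‖ ≤ F) → 0 ≤ D →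
        (∀ y, f y ≠ 0 → D ≤ B5Ineq137Torus.T P 0 x₁ y) → (∀ y, f y ≠ 0 → D ≤ B5Ineq137Torus.T P 0 x₂ y) →
        ((P.L : ℝ) ^ k / B5Ineq137Torus.T P 0 x₁ x₂) ^ θ *
          ‖toC (chainHol sq cb (expGauge P e A) n) *
              ((gLocT (B1RG242Torus.α P a k * (P.L : ℝ) ^ (k * P.d)) P.eps⁻¹ (expGauge P e A) k
                  (cubeFamB hPd (P.L ^ k) c M0 sg W (L ^ k * L ^ s)) (lamFam hPd (P.L ^ k) c M0 sg)
                  (cutoff R₁ R₀ (B5Ineq137Torus.T P 0)) *ᵥ f) x₂ -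
                (gBox (B1RG242Torus.α P a k * (P.L : ℝ) ^ (k * P.d)) P.eps⁻¹ (expGauge P e A) k Ω *ᵥ f) x₂) -
            ((gLocT (B1RG242Torus.α P a k * (P.L : ℝ) ^ (k * P.d)) P.eps⁻¹ (expGauge P e A) k
                  (cubeFamB hPd (P.L ^ k) c M0 sg W (L ^ k * L ^ s)) (lamFam hPd (P.L ^ k) c M0 sg)
                  (cutoff R₁ R₀ (B5Ineq137Torus.T P 0)) *ᵥ f) x₁ -
                (gBox (B1RG242Torus.α P a k * (P.L : ℝ) ^ (k * P.d)) P.eps⁻¹ (expGauge P e A) k Ω *ᵥ f) x₁)‖ ≤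
          P.spacing k ^ 2 * (c₀ * ((⌊(((P.L : ℝ) ^ k) - 1 + R₀) / sg⌋₊ + 3) ^ (d + 1) * (1 + (P.L : ℝ) ^ k * ((R₀ - R₁)⁻¹ + (sg : ℝ)⁻¹)) *
              Real.exp (-(1 / (8 * (L : ℝ) ^ s) * (((P.L : ℝ) ^ k)⁻¹ * (2 * R - 1)))) +
            (1 + (P.L : ℝ) ^ k * (R₀ - R₁)⁻¹) * Real.exp (-(1 / (8 * (L : ℝ) ^ s) / 2 * (((P.L : ℝ) ^ k)⁻¹ * (R₁ - 1))))) *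
            Real.exp (-(1 / (8 * (L : ℝ) ^ s) / 2 * (((P.L : ℝ) ^ k)⁻¹ * D))) * F) := by
  obtain ⟨K, hK0, hK⟩ := exists_abs_cutoff_sub_le
  obtain ⟨s₁, H1⟩ := deriv231_regular_region_of_lipschitz d L hL ha e creg β hcreg hβ hK0
  obtain ⟨s₂, H2⟩ := opClose231_regular_region_cwt d L hL ha e creg β hcreg hβ
  refine ⟨max s₁ s₂, fun s hs => ?_⟩
  obtain ⟨c₁, e₁, hc₁, he₁, G1⟩ := H1 s ((le_max_left _ _).trans hs)
  obtain ⟨c₂, e₂, hc₂, he₂, G2⟩ := H2 s ((le_max_right _ _).trans hs)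
  set δ₀ : ℝ := 1 / (8 * (L : ℝ) ^ s) with hδ₀def
  refine ⟨max (((d : ℝ) + 1) * Real.exp (δ₀ / 2) * c₁) (2 * c₂), min e₁ e₂, lt_max_of_lt_right (by positivity), lt_min he₁ he₂, ?_⟩
  intro P hPd hPL k hk1 hkK hks hsize Ω hΩ A ec hec hece hreg c M0 hfit0 hN0 hΩ₀ sg W hsg R R₀ R₁ hRm hR₁ hR10 hW hgap θ hθ0 hθ1
    x₁ x₂ n sq cb hsq0 hsqn hJ hnle hchain f F D hF hD hsupp₁ hsupp₂
  have hece₁ : ec ≤ e₁ := hece.trans (min_le_left _ _)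
  have hece₂ : ec ≤ e₂ := hece.trans (min_le_right _ _)
  have hRm' : ((rowMargin L (d + 1) k s : ℕ) : ℝ) < R := by linarith
  set C := max (((d : ℝ) + 1) * Real.exp (δ₀ / 2) * c₁) (2 * c₂) with hCdef
  have hC1 : ((d : ℝ) + 1) * Real.exp (δ₀ / 2) * c₁ ≤ C := le_max_left _ _
  have hC2 : 2 * c₂ ≤ C := le_max_right _ _
  have hC0 : 0 ≤ C := le_trans (by positivity) hC2
  have hLr : (0 : ℝ) < L := by exact_mod_cast (show 0 < L by omega)
  have hδ₀0 : 0 < δ₀ := by rw [hδ₀def]; positivity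
  have hLpos : (0 : ℝ) < P.L := P.cast_L_pos
  have hLk : (0 : ℝ) < (P.L : ℝ) ^ k := pow_pos hLpos _
  have hLkinv : 0 < ((P.L : ℝ) ^ k)⁻¹ := inv_pos.mpr hLk
  have hF0 : 0 ≤ F := (norm_nonneg _).trans (hF x₁)
  have hsp0 : 0 < P.spacing k := P.spacing_pos k
  have heps : 0 < P.eps := P.eps_pos
  have hsr : (0 : ℝ) < sg := by exact_mod_cast hsg
  have hgap' : 0 < R₀ - R₁ := sub_pos.2 hR10
  have hT0 : 0 ≤ B5Ineq137Torus.T P 0 x₁ x₂ := B5Ineq137Torus.T_nonneg P 0 x₁ x₂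
  -- the end points are chain sites
  obtain ⟨hx₁, hdeep₁, -⟩ := hsq0 ▸ hchain 0 (Nat.zero_le n)
  obtain ⟨hx₂, hdeep₂, -⟩ := hsqn ▸ hchain n le_rfl
  -- abbreviations
  set Aop : ℝ := B1RG242Torus.α P a k * (P.L : ℝ) ^ (k * P.d) with hAdef
  set U : GaugeField P 0 U1 := expGauge P e A with hUdef
  -- p13's cut-off of record meets the four hypotheses of r18's generic-Lipschitz derivative member (gen 28's `cutoff_hyps` + `rowHyp_iii`)
  obtain ⟨hζabs, hζ0, hζ1⟩ := cutoff_hyps (hK R₁ R₀ hR10 (B5Ineq137Torus.T P 0)) hK0 hR10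
  have hζR₁ : ∀ x y : Balaban1983to89.Site P 0, B5Ineq137Torus.T P 0 x y ≤ R₁ → cutoff R₁ R₀ (B5Ineq137Torus.T P 0) x y = 1 :=
    fun x y h => rowHyp_iii hR10 x y h
  set ζ := cutoff R₁ R₀ (B5Ineq137Torus.T P 0) with hζdef
  set ψL : Balaban1983to89.Site P 0 → ℂ :=
    gLocT Aop P.eps⁻¹ U k (cubeFamB hPd (P.L ^ k) c M0 sg W (L ^ k * L ^ s)) (lamFam hPd (P.L ^ k) c M0 sg) ζ *ᵥ f with hψLdef
  set ψΩ : Balaban1983to89.Site P 0 → ℂ := gBox Aop P.eps⁻¹ U k Ω *ᵥ f with hψΩdef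
  set ψ : Balaban1983to89.Site P 0 → ℂ := ψL - ψΩ with hψdef
  have hψ : ∀ x, ψL x - ψΩ x = ψ x := fun x => rfl
  set T12 : ℝ := B5Ineq137Torus.T P 0 x₁ x₂ with hT12def
  set m : ℝ := ((⌊(((P.L : ℝ) ^ k) - 1 + R₀) / sg⌋₊ : ℝ) + 3) ^ (d + 1) with hmdef
  have hm0 : 0 ≤ m := by rw [hmdef]; positivity
  set br : ℝ := 1 + (P.L : ℝ) ^ k * ((R₀ - R₁)⁻¹ + (sg : ℝ)⁻¹) with hbrdef
  have hbr1 : 1 ≤ br := by rw [hbrdef]; exact le_add_of_nonneg_right (by positivity)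
  have hbr0 : 0 ≤ br := zero_le_one.trans hbr1
  set br₁ : ℝ := 1 + (P.L : ℝ) ^ k * (R₀ - R₁)⁻¹ with hbr₁def
  have hbr₁1 : 1 ≤ br₁ := by rw [hbr₁def]; exact le_add_of_nonneg_right (by positivity)
  have hbr₁0 : 0 ≤ br₁ := zero_le_one.trans hbr₁1
  set ER : ℝ := Real.exp (-(δ₀ * (((P.L : ℝ) ^ k)⁻¹ * (2 * R - 1)))) with hERdef
  set ER₁ : ℝ := Real.exp (-(δ₀ / 2 * (((P.L : ℝ) ^ k)⁻¹ * (R₁ - 1)))) with hER₁def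
  set Ex : ℝ := Real.exp (-(δ₀ / 2 * (((P.L : ℝ) ^ k)⁻¹ * D))) with hEdef
  have hER0 : 0 < ER := Real.exp_pos _
  have hER₁0 : 0 < ER₁ := Real.exp_pos _
  have hE0 : 0 < Ex := Real.exp_pos _
  set Br : ℝ := m * br * ER + br₁ * ER₁ with hBrdef
  have hBr0 : 0 ≤ Br := by positivity
  have hεD : 0 ≤ ((P.L : ℝ) ^ k)⁻¹ * D := mul_nonneg hLkinv.le hD
  -- the value member's exponentials are dominated by the derivative member's
  have hER_2 : Real.exp (-(δ₀ * (((P.L : ℝ) ^ k)⁻¹ * (2 * R)))) ≤ ER :=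
    Real.exp_le_exp.2 (neg_le_neg (mul_le_mul_of_nonneg_left (mul_le_mul_of_nonneg_left (by linarith) hLkinv.le) hδ₀0.le))
  have hER₁_2 : Real.exp (-(δ₀ / 2 * (((P.L : ℝ) ^ k)⁻¹ * R₁))) ≤ ER₁ :=
    Real.exp_le_exp.2 (neg_le_neg (mul_le_mul_of_nonneg_left (mul_le_mul_of_nonneg_left (by linarith) hLkinv.le) (by positivity)))
  -- the weight
  set w : ℝ := ((P.L : ℝ) ^ k / T12) ^ θ with hwdef
  have hw0 : 0 ≤ w := Real.rpow_nonneg (div_nonneg hLk.le hT0) θ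
  show w * ‖toC (chainHol sq cb U n) * (ψL x₂ - ψΩ x₂) - (ψL x₁ - ψΩ x₁)‖ ≤ _
  rw [hψ, hψ]
  -- the target, factorised
  have hRHS : P.spacing k ^ 2 * (C * Br * Ex * F) =
      P.spacing k ^ 2 * (C * ((⌊(((P.L : ℝ) ^ k) - 1 + R₀) / sg⌋₊ + 3) ^ (d + 1) * (1 + (P.L : ℝ) ^ k * ((R₀ - R₁)⁻¹ + (sg : ℝ)⁻¹)) *
          Real.exp (-(δ₀ * (((P.L : ℝ) ^ k)⁻¹ * (2 * R - 1)))) +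
        (1 + (P.L : ℝ) ^ k * (R₀ - R₁)⁻¹) * Real.exp (-(δ₀ / 2 * (((P.L : ℝ) ^ k)⁻¹ * (R₁ - 1))))) *
        Real.exp (-(δ₀ / 2 * (((P.L : ℝ) ^ k)⁻¹ * D))) * F) := by
    rw [hBrdef, hmdef, hbrdef, hbr₁def, hERdef, hER₁def, hEdef]
  rw [← hRHS]
  by_cases hnear : T12 ≤ (P.L : ℝ) ^ k
  · /- NEAR PAIRS: r18's derivative member telescoped along the contour at the non-flat `u` -/
    -- the shortened support distance along the contour
    set D' : ℝ := max (D - T12) 0 with hD'def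
    have hD'0 : 0 ≤ D' := le_max_right _ _
    -- the per-bond bound
    set B₁ : ℝ := P.spacing k * (c₁ * (((⌊(((P.L : ℝ) ^ k) - 1 + R₀) / sg⌋₊ : ℝ) + 3) ^ (d + 1) *
        (1 + (P.L : ℝ) ^ k * ((R₀ - R₁)⁻¹ + (sg : ℝ)⁻¹)) * Real.exp (-(1 / (8 * (L : ℝ) ^ s) * (((P.L : ℝ) ^ k)⁻¹ * (2 * R - 1)))) +
      (1 + (P.L : ℝ) ^ k * (R₀ - R₁)⁻¹) * Real.exp (-(1 / (8 * (L : ℝ) ^ s) / 2 * (((P.L : ℝ) ^ k)⁻¹ * (R₁ - 1))))) *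
      Real.exp (-(1 / (8 * (L : ℝ) ^ s) / 2 * (((P.L : ℝ) ^ k)⁻¹ * D'))) * F) with hB₁def
    have hB₁0 : 0 ≤ B₁ := by rw [hB₁def]; positivity
    have hbond : ∀ m' < n, ‖covD P.eps⁻¹ (cfg U) ψ (cb m')‖ ≤ B₁ := by
      intro m' hm'
      obtain ⟨hmem0, hdeep0, hclose0⟩ := hchain m' hm'.le
      obtain ⟨hmem1, hdeep1, hclose1⟩ := hchain (m' + 1) (Nat.succ_le_of_lt hm')
      have hb : cb m' = ⟨(cb m').src, (cb m').dir⟩ := rfl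
      have htgt : (cb m').tgt = (cb m').src.shift (cb m').dir := rfl
      -- both endpoints of the bond are chain sites
      have hends : ((cb m').src ∈ (cubeT hPd (P.L ^ k) c fun i => P.L ^ k * M0 i) ∧
          (∀ i, R₀ + R ≤ (boxCoord hPd (P.L ^ k) c (cb m').src i : ℝ) ∧
            (boxCoord hPd (P.L ^ k) c (cb m').src i : ℝ) + (R₀ + R) ≤ (P.L ^ k * M0 i : ℕ) - 1) ∧
          B5Ineq137Torus.T P 0 x₁ (cb m').src ≤ T12) ∧
          ((cb m').src.shift (cb m').dir ∈ (cubeT hPd (P.L ^ k) c fun i => P.L ^ k * M0 i) ∧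
          (∀ i, R₀ + R ≤ (boxCoord hPd (P.L ^ k) c ((cb m').src.shift (cb m').dir) i : ℝ) ∧
            (boxCoord hPd (P.L ^ k) c ((cb m').src.shift (cb m').dir) i : ℝ) + (R₀ + R) ≤ (P.L ^ k * M0 i : ℕ) - 1)) := by
        rw [← htgt]
        rcases hJ m' hm' with ⟨h1, h2⟩ | ⟨h1, h2⟩
        · rw [h1, h2]; exact ⟨⟨hmem0, hdeep0, hclose0⟩, hmem1, hdeep1⟩
        · rw [h1, h2]; exact ⟨⟨hmem1, hdeep1, hclose1⟩, hmem0, hdeep0⟩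
      obtain ⟨⟨hzmem, hzdeep, hzclose⟩, hzemem, hzedeep⟩ := hends
      -- the support of `f` seen from the bond: `≥ D − T12`
      have hD'supp : ∀ y, f y ≠ 0 → D' ≤ B5Ineq137Torus.T P 0 (cb m').src y := by
        intro y hy
        refine max_le ?_ (B5Ineq137Torus.T_nonneg P 0 _ y)
        have h1 := hsupp₁ y hy
        have h2 := B5Ineq137Torus.T_triangle P 0 x₁ (cb m').src y
        linarith
      have hder := G1 P hPd hPL k hk1 hkK hks hsize Ω hΩ A ec hec hece₁ hreg c M0 hfit0 hN0 hΩ₀ sg W hsg R R₀ R₁ hRm hR₁ hR10 hW hgap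
        ζ hζabs hζ0 hζR₁ hζ1 (cb m').src (cb m').dir hzmem hzdeep hzemem hzedeep f F D' hF hD'0 hD'supp
      rw [← covD_sub, ← hb] at hder
      exact hder
    -- telescoping along the contour
    have htel := norm_transport_sub_le_sum_covD U (inv_ne_zero heps.ne') ψ sq cb n hJ
    rw [hsq0, hsqn, abs_inv, abs_of_pos heps, inv_inv] at htel
    have hsum : ∑ m' ∈ Finset.range n, ‖covD P.eps⁻¹ (cfg U) ψ (cb m')‖ ≤ n * B₁ := by
      calc ∑ m' ∈ Finset.range n, ‖covD P.eps⁻¹ (cfg U) ψ (cb m')‖ ≤ ∑ _m' ∈ Finset.range n, B₁ :=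
            Finset.sum_le_sum fun m' hm' => hbond m' (Finset.mem_range.1 hm')
        _ = n * B₁ := by rw [Finset.sum_const, Finset.card_range, nsmul_eq_mul]
    have hdiff : ‖toC (chainHol sq cb U n) * ψ x₂ - ψ x₁‖ ≤ P.eps * (n * B₁) :=
      htel.trans (mul_le_mul_of_nonneg_left hsum heps.le)
    -- the exponent: `D' ≥ D − T12 ≥ D − L^k`
    have hexpD' : Real.exp (-(δ₀ / 2 * (((P.L : ℝ) ^ k)⁻¹ * D'))) ≤ Real.exp (δ₀ / 2) * Ex := by
      have h1 : D - T12 ≤ D' := le_max_left _ _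
      have h2 : ((P.L : ℝ) ^ k)⁻¹ * T12 ≤ 1 := by
        rw [inv_mul_le_iff₀ hLk, mul_one]; exact hnear
      have h3 : -(δ₀ / 2 * (((P.L : ℝ) ^ k)⁻¹ * D')) ≤ δ₀ / 2 + -(δ₀ / 2 * (((P.L : ℝ) ^ k)⁻¹ * D)) := by
        have h4 : δ₀ / 2 * (((P.L : ℝ) ^ k)⁻¹ * (D - T12)) ≤ δ₀ / 2 * (((P.L : ℝ) ^ k)⁻¹ * D') :=
          mul_le_mul_of_nonneg_left (mul_le_mul_of_nonneg_left h1 hLkinv.le) (by positivity)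
        have h6 : δ₀ / 2 * (((P.L : ℝ) ^ k)⁻¹ * T12) ≤ δ₀ / 2 * 1 := mul_le_mul_of_nonneg_left h2 (by positivity)
        have h7 : δ₀ / 2 * (((P.L : ℝ) ^ k)⁻¹ * (D - T12)) =
            δ₀ / 2 * (((P.L : ℝ) ^ k)⁻¹ * D) - δ₀ / 2 * (((P.L : ℝ) ^ k)⁻¹ * T12) := by ring
        linarith
      calc Real.exp (-(δ₀ / 2 * (((P.L : ℝ) ^ k)⁻¹ * D'))) ≤ Real.exp (δ₀ / 2 + -(δ₀ / 2 * (((P.L : ℝ) ^ k)⁻¹ * D))) :=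
            Real.exp_le_exp.2 h3
        _ = Real.exp (δ₀ / 2) * Ex := by rw [Real.exp_add]
    have hB₁le : B₁ ≤ P.spacing k * (Real.exp (δ₀ / 2) * c₁ * Br * Ex * F) := by
      rw [hB₁def, ← hmdef, ← hbrdef, ← hbr₁def, ← hδ₀def, ← hERdef, ← hER₁def]
      refine mul_le_mul_of_nonneg_left ?_ hsp0.le
      calc c₁ * (m * br * ER + br₁ * ER₁) * Real.exp (-(δ₀ / 2 * (((P.L : ℝ) ^ k)⁻¹ * D'))) * F
          ≤ c₁ * Br * (Real.exp (δ₀ / 2) * Ex) * F :=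
            mul_le_mul_of_nonneg_right (mul_le_mul_of_nonneg_left hexpD' (by positivity)) hF0
        _ = Real.exp (δ₀ / 2) * c₁ * Br * Ex * F := by ring
    -- the weight against the number of steps: `w·ε·n ≤ (d+1)·L^k·ε`
    have hwT : w * (P.eps * (n * B₁)) ≤ ((d : ℝ) + 1) * (P.eps * (P.L : ℝ) ^ k) * B₁ := by
      rcases hT0.eq_or_lt with hT00 | hTpos
      · have hn0 : (n : ℝ) = 0 := le_antisymm (by rw [← hT00, mul_zero] at hnle; exact hnle) (Nat.cast_nonneg n)
        rw [hn0, zero_mul, mul_zero, mul_zero]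
        positivity
      · have hq : 1 ≤ (P.L : ℝ) ^ k / T12 := by rw [le_div_iff₀ hTpos, one_mul]; exact hnear
        have hw1 : w ≤ (P.L : ℝ) ^ k / T12 := rpow_le_self_of_one_le hq hθ1
        calc w * (P.eps * (n * B₁)) ≤ (P.L : ℝ) ^ k / T12 * (P.eps * ((((d : ℝ) + 1) * T12) * B₁)) :=
              mul_le_mul hw1 (mul_le_mul_of_nonneg_left (mul_le_mul_of_nonneg_right hnle hB₁0) heps.le) (by positivity)
                (div_nonneg hLk.le hT0)
          _ = ((d : ℝ) + 1) * (P.eps * (P.L : ℝ) ^ k) * B₁ := by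
              rw [div_mul_eq_mul_div, div_eq_iff hTpos.ne']
              ring
    have hspacing : P.eps * (P.L : ℝ) ^ k = P.spacing k := by rw [Params.spacing]; ring
    calc w * ‖toC (chainHol sq cb U n) * ψ x₂ - ψ x₁‖ ≤ w * (P.eps * (n * B₁)) := mul_le_mul_of_nonneg_left hdiff hw0
      _ ≤ ((d : ℝ) + 1) * (P.eps * (P.L : ℝ) ^ k) * B₁ := hwT
      _ ≤ ((d : ℝ) + 1) * P.spacing k * (P.spacing k * (Real.exp (δ₀ / 2) * c₁ * Br * Ex * F)) := by
          rw [hspacing]; exact mul_le_mul_of_nonneg_left hB₁le (by positivity)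
      _ = P.spacing k ^ 2 * ((((d : ℝ) + 1) * Real.exp (δ₀ / 2) * c₁) * Br * Ex * F) := by ring
      _ ≤ P.spacing k ^ 2 * (C * Br * Ex * F) := by
          refine mul_le_mul_of_nonneg_left ?_ (sq_nonneg _)
          exact mul_le_mul_of_nonneg_right (mul_le_mul_of_nonneg_right (mul_le_mul_of_nonneg_right hC1 hBr0) hE0.le) hF0
  · /- FAR PAIRS: two (2.31) value members, `|u(Γ)| = 1` -/
    push Not at hnear
    have hTpos : 0 < T12 := hLk.trans hnear
    have hw1 : w ≤ 1 := by
      refine Real.rpow_le_one (div_nonneg hLk.le hT0) ?_ hθ0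
      rw [div_le_one hTpos]; exact hnear.le
    have hR0 : 0 ≤ R := le_trans (Nat.cast_nonneg _) hRm'.le
    have hv₁ := G2 P hPd hPL k hk1 hkK hks hsize Ω hΩ A ec hec hece₂ hreg c M0 hfit0 hΩ₀ sg W hsg R R₀ R₁ hRm' hR₁ hR10 hW hgap x₁ hx₁
      hdeep₁ f F D hF hD hsupp₁
    have hv₂ := G2 P hPd hPL k hk1 hkK hks hsize Ω hΩ A ec hec hece₂ hreg c M0 hfit0 hΩ₀ sg W hsg R R₀ R₁ hRm' hR₁ hR10 hW hgap x₂ hx₂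
      hdeep₂ f F D hF hD hsupp₂
    have hval : ∀ x : Balaban1983to89.Site P 0,
        ‖ψL x - ψΩ x‖ ≤ P.spacing k ^ 2 * (c₂ * (((⌊(((P.L : ℝ) ^ k) - 1 + R₀) / sg⌋₊ : ℝ) + 3) ^ (d + 1) *
            Real.exp (-(1 / (8 * (L : ℝ) ^ s) * (((P.L : ℝ) ^ k)⁻¹ * (2 * R)))) +
              Real.exp (-(1 / (8 * (L : ℝ) ^ s) / 2 * (((P.L : ℝ) ^ k)⁻¹ * R₁)))) *
          Real.exp (-(1 / (8 * (L : ℝ) ^ s) / 2 * (((P.L : ℝ) ^ k)⁻¹ * D))) * F) → ‖ψ x‖ ≤ P.spacing k ^ 2 * (c₂ * Br * Ex * F) := by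
      intro x hx
      rw [← hψ]
      refine hx.trans (mul_le_mul_of_nonneg_left ?_ (sq_nonneg _))
      rw [← hmdef, ← hδ₀def, ← hEdef]
      have hbr_le : m * Real.exp (-(δ₀ * (((P.L : ℝ) ^ k)⁻¹ * (2 * R)))) + Real.exp (-(δ₀ / 2 * (((P.L : ℝ) ^ k)⁻¹ * R₁))) ≤ Br := by
        rw [hBrdef]
        refine add_le_add ?_ ?_
        · calc m * Real.exp (-(δ₀ * (((P.L : ℝ) ^ k)⁻¹ * (2 * R)))) ≤ m * ER := mul_le_mul_of_nonneg_left hER_2 hm0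
            _ = m * 1 * ER := by ring
            _ ≤ m * br * ER := mul_le_mul_of_nonneg_right (mul_le_mul_of_nonneg_left hbr1 hm0) hER0.le
        · calc Real.exp (-(δ₀ / 2 * (((P.L : ℝ) ^ k)⁻¹ * R₁))) ≤ ER₁ := hER₁_2
            _ = 1 * ER₁ := (one_mul _).symm
            _ ≤ br₁ * ER₁ := mul_le_mul_of_nonneg_right hbr₁1 hER₁0.le
      exact mul_le_mul_of_nonneg_right (mul_le_mul_of_nonneg_right (mul_le_mul_of_nonneg_left hbr_le hc₂.le) hE0.le) hF0
    have h1 := hval x₁ hv₁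
    have h2 := hval x₂ hv₂
    have hsub : ‖toC (chainHol sq cb U n) * ψ x₂ - ψ x₁‖ ≤
        P.spacing k ^ 2 * (c₂ * Br * Ex * F) + P.spacing k ^ 2 * (c₂ * Br * Ex * F) := by
      refine (norm_sub_le _ _).trans (add_le_add ?_ h1)
      rw [norm_mul, norm_toC, one_mul]; exact h2
    calc w * ‖toC (chainHol sq cb U n) * ψ x₂ - ψ x₁‖ ≤ ‖toC (chainHol sq cb U n) * ψ x₂ - ψ x₁‖ :=
          mul_le_of_le_one_left (norm_nonneg _) hw1
      _ ≤ P.spacing k ^ 2 * (c₂ * Br * Ex * F) + P.spacing k ^ 2 * (c₂ * Br * Ex * F) := hsub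
      _ = P.spacing k ^ 2 * ((2 * c₂) * Br * Ex * F) := by ring
      _ ≤ P.spacing k ^ 2 * (C * Br * Ex * F) := by
          refine mul_le_mul_of_nonneg_left ?_ (sq_nonneg _)
          exact mul_le_mul_of_nonneg_right (mul_le_mul_of_nonneg_right (mul_le_mul_of_nonneg_right hC2 hBr0) hE0.le) hF0

end Holder

/-! ## §3 The member along the chart staircase: [6]'s *"shortest contour Γ_{x,x′}"* form for near deep pairs -/

section ShortestContour

/-- **THE HÖLDER MEMBER OF ORDER `θ ≤ 1` OF (2.31) FOR A GENERAL BIG-BLOCK REGION `Ω`, `A` (2.23)-REGULAR ON `Ω`, ALONG A SHORTEST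
CONTOUR** ([6] (1.9)'s form: *"Here Γ_{x,x′} denotes a shortest contour connecting the points x, x′"*): with the thresholds and constants of
`holder231_regular_region_cwt`, for every pair `x₁, x₂ ∈ Ω₀` at chart depth `≥ R₀ + R` with `|x₁ − x₂|_T ≤ R₀ + R` THERE IS a bond chain `Γ`
from `x₁` to `x₂` of `≤ (d+1)|x₁ − x₂|_T` steps (p29's chart staircase `exists_admissible_contour`; its sites lie in `Ω₀ ⊆ Ω`) along which, for
every `0 ≤ θ ≤ 1` and every `f` with `‖f‖_∞ ≤ F` supported at sup-torus distance `≥ D ≥ 0` from both points, the bound of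
`holder231_regular_region_cwt` holds against `G_k(Ω,u)`.
[cite: BalabanImbrieJaffe1988, (2.31) p.263] -/
theorem exists_contour_holder231_regular_region_cwt (d L : ℕ) (hL : 2 ≤ L) {a : ℝ} (ha : 0 < a) (e creg β : ℝ) (hcreg : 0 ≤ creg)
    (hβ : 0 < β) :
    ∃ s₀ : ℕ, ∀ s : ℕ, s₀ ≤ s → ∃ c₀ e₁ : ℝ, 0 < c₀ ∧ 0 < e₁ ∧
      ∀ (P : Params) (hPd : P.d = d + 1), P.L = L → ∀ (k : ℕ), 1 ≤ k → k ≤ P.K → k + s ≤ P.m + P.K →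
      3 * (L ^ k * L ^ s) ≤ P.sitesPerDir 0 →
      ∀ (Ω : Finset (Balaban1983to89.Site P 0)),
        (∀ z z' : Balaban1983to89.Site P 0, (∀ μ, (z μ).val / (L ^ k * L ^ s) = (z' μ).val / (L ^ k * L ^ s)) → (z ∈ Ω ↔ z' ∈ Ω)) →
      ∀ (A : PBond P 0 → ℝ) (ec : ℝ), 0 < ec → ec ≤ e₁ →
      (∀ z ∈ Ω, ∀ (μ ν : Fin P.d),
          P.spacing k * |e| / ec * |A ⟨z.shift μ, ν⟩ - A ⟨z, ν⟩| ≤ creg * ec ^ (β - 1) / (L : ℝ) ^ k) →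
      ∀ (c M0 : Fin (d + 1) → ℕ), (∀ i, c i * P.L ^ k + P.L ^ k * M0 i ≤ P.sitesPerDir 0) → (∀ i, P.L ^ k * M0 i < P.sitesPerDir 0) →
        bbHull (L ^ k * L ^ s) (cubeT hPd (P.L ^ k) c fun i => P.L ^ k * M0 i) ⊆ Ω →
      ∀ (sg W : ℕ), 1 ≤ sg → ∀ (R R₀ R₁ : ℝ), ((rowMargin L (d + 1) k s : ℕ) : ℝ) + 1 < R → 0 ≤ R₁ → R₁ < R₀ →
        2 * (sg : ℝ) / 3 + R₀ / 2 + R ≤ W → (∀ i, ((P.L ^ k * M0 i : ℕ) : ℝ) + R ≤ P.sitesPerDir 0) →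
      ∀ (x₁ x₂ : Balaban1983to89.Site P 0),
        x₁ ∈ (cubeT hPd (P.L ^ k) c fun i => P.L ^ k * M0 i) →
        (∀ i, R₀ + R ≤ (boxCoord hPd (P.L ^ k) c x₁ i : ℝ) ∧ (boxCoord hPd (P.L ^ k) c x₁ i : ℝ) + (R₀ + R) ≤ (P.L ^ k * M0 i : ℕ) - 1) →
        x₂ ∈ (cubeT hPd (P.L ^ k) c fun i => P.L ^ k * M0 i) →
        (∀ i, R₀ + R ≤ (boxCoord hPd (P.L ^ k) c x₂ i : ℝ) ∧ (boxCoord hPd (P.L ^ k) c x₂ i : ℝ) + (R₀ + R) ≤ (P.L ^ k * M0 i : ℕ) - 1) →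
        B5Ineq137Torus.T P 0 x₁ x₂ ≤ R₀ + R →
      ∃ (N : ℕ) (sq : ℕ → Balaban1983to89.Site P 0) (cb : ℕ → PBond P 0), sq 0 = x₁ ∧ sq N = x₂ ∧
        (∀ m < N, Joins (cb m) (sq m) (sq (m + 1))) ∧ (N : ℝ) ≤ ((d : ℝ) + 1) * B5Ineq137Torus.T P 0 x₁ x₂ ∧
      ∀ (θ : ℝ), 0 ≤ θ → θ ≤ 1 →
      ∀ (f : Balaban1983to89.Site P 0 → ℂ) (F D : ℝ), (∀ y, ‖f y‖ ≤ F) → 0 ≤ D →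
        (∀ y, f y ≠ 0 → D ≤ B5Ineq137Torus.T P 0 x₁ y) → (∀ y, f y ≠ 0 → D ≤ B5Ineq137Torus.T P 0 x₂ y) →
        ((P.L : ℝ) ^ k / B5Ineq137Torus.T P 0 x₁ x₂) ^ θ *
          ‖toC (chainHol sq cb (expGauge P e A) N) *
              ((gLocT (B1RG242Torus.α P a k * (P.L : ℝ) ^ (k * P.d)) P.eps⁻¹ (expGauge P e A) k
                  (cubeFamB hPd (P.L ^ k) c M0 sg W (L ^ k * L ^ s)) (lamFam hPd (P.L ^ k) c M0 sg)
                  (cutoff R₁ R₀ (B5Ineq137Torus.T P 0)) *ᵥ f) x₂ -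
                (gBox (B1RG242Torus.α P a k * (P.L : ℝ) ^ (k * P.d)) P.eps⁻¹ (expGauge P e A) k Ω *ᵥ f) x₂) -
            ((gLocT (B1RG242Torus.α P a k * (P.L : ℝ) ^ (k * P.d)) P.eps⁻¹ (expGauge P e A) k
                  (cubeFamB hPd (P.L ^ k) c M0 sg W (L ^ k * L ^ s)) (lamFam hPd (P.L ^ k) c M0 sg)
                  (cutoff R₁ R₀ (B5Ineq137Torus.T P 0)) *ᵥ f) x₁ -
                (gBox (B1RG242Torus.α P a k * (P.L : ℝ) ^ (k * P.d)) P.eps⁻¹ (expGauge P e A) k Ω *ᵥ f) x₁)‖ ≤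
          P.spacing k ^ 2 * (c₀ * ((⌊(((P.L : ℝ) ^ k) - 1 + R₀) / sg⌋₊ + 3) ^ (d + 1) * (1 + (P.L : ℝ) ^ k * ((R₀ - R₁)⁻¹ + (sg : ℝ)⁻¹)) *
              Real.exp (-(1 / (8 * (L : ℝ) ^ s) * (((P.L : ℝ) ^ k)⁻¹ * (2 * R - 1)))) +
            (1 + (P.L : ℝ) ^ k * (R₀ - R₁)⁻¹) * Real.exp (-(1 / (8 * (L : ℝ) ^ s) / 2 * (((P.L : ℝ) ^ k)⁻¹ * (R₁ - 1))))) *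
            Real.exp (-(1 / (8 * (L : ℝ) ^ s) / 2 * (((P.L : ℝ) ^ k)⁻¹ * D))) * F) := by
  obtain ⟨s₀, H⟩ := holder231_regular_region_cwt d L hL ha e creg β hcreg hβ
  refine ⟨s₀, fun s hs => ?_⟩
  obtain ⟨c₀, e₁, hc₀, he₁, G⟩ := H s hs
  refine ⟨c₀, e₁, hc₀, he₁, ?_⟩
  intro P hPd hPL k hk1 hkK hks hsize Ω hΩ A ec hec hece hreg c M0 hfit0 hN0 hΩ₀ sg W hsg R R₀ R₁ hRm hR₁ hR10 hW hgap x₁ x₂ hx₁ hdeep₁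
    hx₂ hdeep₂ hT
  obtain ⟨N, sq, cb, h0, hN, hJ, hNle, hchain⟩ := exists_admissible_contour hPd hfit0 hx₁ hdeep₁ hx₂ hdeep₂ hT
  refine ⟨N, sq, cb, h0, hN, hJ, hNle, fun θ hθ0 hθ1 f F D hF hD hD₁ hD₂ => ?_⟩
  have hchain' : ∀ m ≤ N, sq m ∈ (cubeT hPd (P.L ^ k) c fun i => P.L ^ k * M0 i) ∧
      (∀ i, R₀ + R ≤ (boxCoord hPd (P.L ^ k) c (sq m) i : ℝ) ∧ (boxCoord hPd (P.L ^ k) c (sq m) i : ℝ) + (R₀ + R) ≤ (P.L ^ k * M0 i : ℕ) - 1) ∧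
      B5Ineq137Torus.T P 0 x₁ (sq m) ≤ B5Ineq137Torus.T P 0 x₁ x₂ := fun m hm => by
    obtain ⟨h1, h2, h3⟩ := hchain m hm
    exact ⟨h1, fun i => by simpa only [min_self] using h2 i, h3⟩
  exact G P hPd hPL k hk1 hkK hks hsize Ω hΩ A ec hec hece hreg c M0 hfit0 hN0 hΩ₀ sg W hsg R R₀ R₁ hRm hR₁ hR10 hW hgap θ hθ0 hθ1 x₁ x₂ N
    sq cb h0 hN hJ hNle hchain' f F D hF hD hD₁ hD₂

end ShortestContour

/-! ## §4 (v1.1) Non-vacuity: every hypothesis of `exists_contour_holder231_regular_region_cwt` met at once, with a PROPER region `Ω ⊊ T^{(0)}`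
and a pair of DISTINCT deep points, on a genuine `Setup` torus chosen after the thresholds -/

section Instance

open BIJ88NeumannPropagatorFlatDecayCube (mem_cubeT_iff_val)
open BIJ88Close231RegularTorusCwt (mem_bbHull bbHull_bigBlock)
open BIJ88LocDeriv230FlatTorus (T_shift_le_one)

/-- The instance torus of the series (r18's §5 torus): `d = 1`, `L = 3` (odd), `K = 1`, `m = s + 6` — `|T^{(0)}| = 2·3^{s+7}` fine sites per
direction. [cite: Balaban1987RG1, (0.1) p.251] -/
private theorem sites_Ps (s : ℕ) :
    (⟨1, 3, s + 6, 1, le_rfl, ⟨⟨1, rfl⟩, Nat.one_lt_succ_succ 1⟩⟩ : Params).sitesPerDir 0 = 2 * 3 ^ (s + 7) := by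
  show 2 * 3 ^ (s + 6 + 1 - 0) = 2 * 3 ^ (s + 7)
  rfl

/-- kernel: `rowMargin 3 1 1 s ≤ 16·3^s + 7`. [folklore] -/
private theorem rowMargin_le (s : ℕ) : rowMargin 3 (0 + 1) 1 s ≤ 16 * 3 ^ s + 7 := by
  unfold rowMargin
  have : (3 : ℕ) ^ 1 = 3 := by norm_num
  rw [this]
  omega

/-- **THE HYPOTHESES OF `exists_contour_holder231_regular_region_cwt` (HENCE OF `holder231_regular_region_cwt`) ARE JOINTLY SATISFIABLE WITH A
PROPER REGION AND TWO DISTINCT DEEP POINTS — THRESHOLDS INCLUDED** (so the Hölder-`θ ≤ 1` member of (2.31) for a general region at a regular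
background is not a statement about the empty set, nor only about `Ω = T_η` or a degenerate pair): for every charge/coupling data
`(a, e, c, β)` THERE ARE a block exponent `s` (the threshold `s₀` itself), constants `c₀, e₁ > 0`, and — chosen AFTER them — the `Setup` torus
`ℤ/(2·3^{s+7})` (`d = 1`, `L = 3`, `m = s + 6`, `K = 1`; r18's §5 torus), the level `k = 1`, the reference box `Ω₀ = [0, 3^{s+5})` (`c = 0`,
`M₀ = 3^{s+4}`), THE REGION `Ω = bbHull (3·3^s) Ω₀ = [0, 3^{s+5})` (a union of big blocks MISSING the site `3^{s+5}`, so `Ω ≠ T^{(0)}`), the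
background `A = 0` (regular on `Ω` at `e_k = e₁`), grid spacing `s_g = 1`, radii `R = rowMargin + 2 > rowMargin + 1`, `R₀ = 1`, `R₁ = 0`,
half-width `W = rowMargin + 4` and the two NEIGHBOURING sites `x₁ ≡ rowMargin + 3`, `x₂ = x₁ + e_0 ≡ rowMargin + 4` of `Ω₀`, both at chart
depth `≥ R₀ + R`, with `|x₁ − x₂|_T ≤ 1 ≤ R₀ + R`, meeting EVERY displayed hypothesis of §3; consequently THERE IS an admissible contour from `x₁` to
`x₂` along which the Hölder bound of §2 holds for every exponent `0 ≤ θ ≤ 1` and every source `f` (`D = 0`) — r18 gen 25's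
`opClose231_regular_region_cwt_nonvacuous` pattern. [cite: BalabanImbrieJaffe1988, (2.31) p.263] -/
theorem holder231_regular_region_cwt_nonvacuous {a : ℝ} (ha : 0 < a) (e creg β : ℝ) (hcreg : 0 ≤ creg) (hβ : 0 < β) :
    ∃ (s : ℕ) (P : Params) (hPd : P.d = 0 + 1), P.L = 3 ∧ P.sitesPerDir 0 = 2 * 3 ^ (s + 7) ∧
    ∃ c₀ e₁ : ℝ, 0 < c₀ ∧ 0 < e₁ ∧ ∃ (M W : ℕ) (R : ℝ) (x₁ x₂ : Balaban1983to89.Site P 0), 0 < R ∧ x₁ ≠ x₂ ∧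
      x₁ ∈ (cubeT hPd (P.L ^ 1) (fun _ => 0) fun i => P.L ^ 1 * (fun _ => M) i) ∧
      x₂ ∈ (cubeT hPd (P.L ^ 1) (fun _ => 0) fun i => P.L ^ 1 * (fun _ => M) i) ∧
      (∃ w : Balaban1983to89.Site P 0, w ∉ bbHull (3 ^ 1 * 3 ^ s) (cubeT hPd (P.L ^ 1) (fun _ => 0) fun i => P.L ^ 1 * (fun _ => M) i)) ∧
      ∃ (N : ℕ) (sq : ℕ → Balaban1983to89.Site P 0) (cb : ℕ → PBond P 0), sq 0 = x₁ ∧ sq N = x₂ ∧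
        (∀ m < N, Joins (cb m) (sq m) (sq (m + 1))) ∧ (N : ℝ) ≤ (((0 : ℕ) : ℝ) + 1) * B5Ineq137Torus.T P 0 x₁ x₂ ∧
      ∀ (θ : ℝ), 0 ≤ θ → θ ≤ 1 → ∀ (f : Balaban1983to89.Site P 0 → ℂ) (F : ℝ), (∀ y, ‖f y‖ ≤ F) →
        ((P.L : ℝ) ^ 1 / B5Ineq137Torus.T P 0 x₁ x₂) ^ θ *
          ‖toC (chainHol sq cb (expGauge P e (fun _ => 0 : PBond P 0 → ℝ)) N) *
              ((gLocT (B1RG242Torus.α P a 1 * (P.L : ℝ) ^ (1 * P.d)) P.eps⁻¹ (expGauge P e (fun _ => 0 : PBond P 0 → ℝ)) 1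
                  (cubeFamB hPd (P.L ^ 1) (fun _ => 0) (fun _ => M) 1 W (3 ^ 1 * 3 ^ s)) (lamFam hPd (P.L ^ 1) (fun _ => 0) (fun _ => M) 1)
                  (cutoff 0 1 (B5Ineq137Torus.T P 0)) *ᵥ f) x₂ -
                (gBox (B1RG242Torus.α P a 1 * (P.L : ℝ) ^ (1 * P.d)) P.eps⁻¹ (expGauge P e (fun _ => 0 : PBond P 0 → ℝ)) 1
                  (bbHull (3 ^ 1 * 3 ^ s) (cubeT hPd (P.L ^ 1) (fun _ => 0) fun i => P.L ^ 1 * (fun _ => M) i)) *ᵥ f) x₂) -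
            ((gLocT (B1RG242Torus.α P a 1 * (P.L : ℝ) ^ (1 * P.d)) P.eps⁻¹ (expGauge P e (fun _ => 0 : PBond P 0 → ℝ)) 1
                  (cubeFamB hPd (P.L ^ 1) (fun _ => 0) (fun _ => M) 1 W (3 ^ 1 * 3 ^ s)) (lamFam hPd (P.L ^ 1) (fun _ => 0) (fun _ => M) 1)
                  (cutoff 0 1 (B5Ineq137Torus.T P 0)) *ᵥ f) x₁ -
                (gBox (B1RG242Torus.α P a 1 * (P.L : ℝ) ^ (1 * P.d)) P.eps⁻¹ (expGauge P e (fun _ => 0 : PBond P 0 → ℝ)) 1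
                  (bbHull (3 ^ 1 * 3 ^ s) (cubeT hPd (P.L ^ 1) (fun _ => 0) fun i => P.L ^ 1 * (fun _ => M) i)) *ᵥ f) x₁)‖ ≤
          P.spacing 1 ^ 2 * (c₀ * ((⌊(((P.L : ℝ) ^ 1) - 1 + 1) / (1 : ℕ)⌋₊ + 3) ^ (0 + 1) * (1 + (P.L : ℝ) ^ 1 * ((1 - 0)⁻¹ + ((1 : ℕ) : ℝ)⁻¹)) *
              Real.exp (-(1 / (8 * (3 : ℝ) ^ s) * (((P.L : ℝ) ^ 1)⁻¹ * (2 * R - 1)))) +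
            (1 + (P.L : ℝ) ^ 1 * (1 - 0)⁻¹) * Real.exp (-(1 / (8 * (3 : ℝ) ^ s) / 2 * (((P.L : ℝ) ^ 1)⁻¹ * (0 - 1))))) *
            Real.exp (-(1 / (8 * (3 : ℝ) ^ s) / 2 * (((P.L : ℝ) ^ 1)⁻¹ * 0))) * F) := by
  obtain ⟨s₀, H0⟩ := exists_contour_holder231_regular_region_cwt 0 3 (by norm_num) ha e creg β hcreg hβ
  obtain ⟨c₀, e₁, hc₀, he₁, H⟩ := H0 s₀ le_rfl
  set s := s₀ with hsdef
  -- the torus, the margin, the box, the two points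
  set P : Params := ⟨1, 3, s + 6, 1, le_rfl, ⟨⟨1, rfl⟩, Nat.one_lt_succ_succ 1⟩⟩ with hPdef
  have hN : P.sitesPerDir 0 = 2 * 3 ^ (s + 7) := sites_Ps s
  set ρ : ℕ := rowMargin 3 (0 + 1) 1 s with hρdef
  have hρ : ρ ≤ 16 * 3 ^ s + 7 := rowMargin_le s
  have hX1 : 1 ≤ 3 ^ s := Nat.one_le_pow _ _ (by norm_num)
  have h35 : (3 : ℕ) ^ (s + 5) = 243 * 3 ^ s := by rw [pow_add]; ring
  have h37 : (3 : ℕ) ^ (s + 7) = 2187 * 3 ^ s := by rw [pow_add]; ring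
  have h34 : (3 : ℕ) ^ 1 * 3 ^ (s + 4) = 3 ^ (s + 5) := by rw [← pow_add]; ring_nf
  have h31 : (3 : ℕ) ^ 1 * 3 ^ s = 3 * 3 ^ s := by norm_num
  set v : ℕ := ρ + 3 with hvdef
  have hvN : v + 1 < P.sitesPerDir 0 := by rw [hN, h37]; omega
  set x₁ : Balaban1983to89.Site P 0 := fun _ => ((v : ℕ) : ZMod (P.sitesPerDir 0)) with hx₁def
  set x₂ : Balaban1983to89.Site P 0 := fun _ => ((v + 1 : ℕ) : ZMod (P.sitesPerDir 0)) with hx₂def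
  have hxv₁ : ∀ μ : Fin P.d, (x₁ μ).val = v := by
    intro μ
    show ZMod.val ((v : ℕ) : ZMod (P.sitesPerDir 0)) = v
    rw [ZMod.val_natCast, Nat.mod_eq_of_lt (by omega)]
  have hxv₂ : ∀ μ : Fin P.d, (x₂ μ).val = v + 1 := by
    intro μ
    show ZMod.val ((v + 1 : ℕ) : ZMod (P.sitesPerDir 0)) = v + 1
    rw [ZMod.val_natCast, Nat.mod_eq_of_lt hvN]
  set μ0 : Fin P.d := ⟨0, by show 0 < 1; exact Nat.one_pos⟩ with hμ0def
  have hμall : ∀ ν : Fin P.d, ν = μ0 := fun ν => by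
    have hν := ν.isLt
    have hd : P.d = 1 := rfl
    apply Fin.ext
    show ν.val = 0
    omega
  -- `x₂` is the neighbour `x₁ + e_0`
  have hshift : x₁.shift μ0 = x₂ := by
    funext ν
    rw [hμall ν]
    show Function.update x₁ μ0 (x₁ μ0 + 1) μ0 = x₂ μ0
    rw [Function.update_self]
    show ((v : ℕ) : ZMod (P.sitesPerDir 0)) + 1 = ((v + 1 : ℕ) : ZMod (P.sitesPerDir 0))
    push_cast; ring
  have hne : x₁ ≠ x₂ := by
    intro h
    have h1 := hxv₁ μ0
    rw [h, hxv₂ μ0] at h1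
    omega
  have hT12 : B5Ineq137Torus.T P 0 x₁ x₂ ≤ 1 := by rw [← hshift]; exact T_shift_le_one x₁ μ0
  have hfit : ∀ i : Fin (0 + 1), (fun _ => 0 : Fin (0 + 1) → ℕ) i * P.L ^ 1 + P.L ^ 1 * (fun _ => 3 ^ (s + 4) : Fin (0 + 1) → ℕ) i ≤
      P.sitesPerDir 0 := by
    intro i
    show 0 * 3 ^ 1 + 3 ^ 1 * 3 ^ (s + 4) ≤ P.sitesPerDir 0
    rw [hN, h34, h35, h37]; omega
  have hN0 : ∀ i : Fin (0 + 1), P.L ^ 1 * (fun _ => 3 ^ (s + 4) : Fin (0 + 1) → ℕ) i < P.sitesPerDir 0 := by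
    intro i
    show 3 ^ 1 * 3 ^ (s + 4) < P.sitesPerDir 0
    rw [hN, h34, h35, h37]; omega
  have hxmem₁ : x₁ ∈ (cubeT rfl (P.L ^ 1) (fun _ => 0) fun i => P.L ^ 1 * (fun _ => 3 ^ (s + 4) : Fin (0 + 1) → ℕ) i) := by
    rw [mem_cubeT_iff_val rfl hfit]
    intro μ
    rw [hxv₁ μ]
    show 0 * 3 ^ 1 ≤ v ∧ v < 0 * 3 ^ 1 + 3 ^ 1 * 3 ^ (s + 4)
    rw [h34, h35]; omega
  have hxmem₂ : x₂ ∈ (cubeT rfl (P.L ^ 1) (fun _ => 0) fun i => P.L ^ 1 * (fun _ => 3 ^ (s + 4) : Fin (0 + 1) → ℕ) i) := by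
    rw [mem_cubeT_iff_val rfl hfit]
    intro μ
    rw [hxv₂ μ]
    show 0 * 3 ^ 1 ≤ v + 1 ∧ v + 1 < 0 * 3 ^ 1 + 3 ^ 1 * 3 ^ (s + 4)
    rw [h34, h35]; omega
  -- the region: the big-block hull of `Ω₀` (= `Ω₀` itself, block-aligned), a union of big blocks missing the site `3^{s+5}`
  set Ω : Finset (Balaban1983to89.Site P 0) :=
    bbHull (3 ^ 1 * 3 ^ s) (cubeT (rfl : P.d = 0 + 1) (P.L ^ 1) (fun _ => 0) fun i => P.L ^ 1 * (fun _ => 3 ^ (s + 4) : Fin (0 + 1) → ℕ) i)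
    with hΩdef
  have hwN : 3 ^ (s + 5) < P.sitesPerDir 0 := by rw [hN, h35, h37]; omega
  set w : Balaban1983to89.Site P 0 := fun _ => ((3 ^ (s + 5) : ℕ) : ZMod (P.sitesPerDir 0)) with hwdef
  have hwv : ∀ μ : Fin P.d, (w μ).val = 3 ^ (s + 5) := by
    intro μ
    show ZMod.val (((3 ^ (s + 5) : ℕ) : ℕ) : ZMod (P.sitesPerDir 0)) = 3 ^ (s + 5)
    rw [ZMod.val_natCast, Nat.mod_eq_of_lt hwN]
  have hwout : w ∉ Ω := by
    intro hw
    obtain ⟨y, hy, hwy⟩ := mem_bbHull.1 hw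
    have hy0 := ((mem_cubeT_iff_val rfl hfit y).1 hy) μ0
    have hμ := hwy μ0
    rw [hwv μ0] at hμ
    have hy1 : (y μ0).val < 3 ^ (s + 5) := by
      have := hy0.2
      simp only [zero_mul, zero_add] at this
      rw [h34] at this
      exact this
    have e1 : 3 ^ (s + 5) / (3 ^ 1 * 3 ^ s) = 81 := by
      rw [h31, h35, show 243 * 3 ^ s = 81 * (3 * 3 ^ s) by ring]
      exact Nat.mul_div_cancel _ (by positivity)
    have e2 : (y μ0).val / (3 ^ 1 * 3 ^ s) < 81 := by
      rw [h31]
      refine (Nat.div_lt_iff_lt_mul (by positivity)).2 ?_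
      rw [h35] at hy1
      linarith
    rw [e1] at hμ
    omega
  -- the chart depths of the two points
  have e243 : ((P.L ^ 1 * 3 ^ (s + 4) : ℕ) : ℝ) = 243 * (3 : ℝ) ^ s := by
    rw [show P.L = 3 from rfl, h34, h35]; push_cast; ring
  have hρr : (ρ : ℝ) ≤ 16 * (3 : ℝ) ^ s + 7 := by exact_mod_cast hρ
  have hXr : (1 : ℝ) ≤ (3 : ℝ) ^ s := by exact_mod_cast hX1
  have hdeep₁ : ∀ i : Fin (0 + 1), (1 : ℝ) + ((ρ : ℝ) + 2) ≤ (boxCoord (rfl : P.d = 0 + 1) (P.L ^ 1) (fun _ => 0) x₁ i : ℝ) ∧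
      (boxCoord (rfl : P.d = 0 + 1) (P.L ^ 1) (fun _ => 0) x₁ i : ℝ) + (1 + ((ρ : ℝ) + 2)) ≤
        ((P.L ^ 1 * (fun _ => 3 ^ (s + 4) : Fin (0 + 1) → ℕ) i : ℕ) : ℝ) - 1 := by
    intro i
    have hb : (boxCoord (rfl : P.d = 0 + 1) (P.L ^ 1) (fun _ => 0) x₁ i : ℝ) = v := by
      unfold boxCoord
      rw [hxv₁ (Fin.cast (rfl : P.d = 0 + 1).symm i)]
      push_cast
      ring
    rw [hb, e243, hvdef]; push_cast
    constructor <;> linarith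
  have hdeep₂ : ∀ i : Fin (0 + 1), (1 : ℝ) + ((ρ : ℝ) + 2) ≤ (boxCoord (rfl : P.d = 0 + 1) (P.L ^ 1) (fun _ => 0) x₂ i : ℝ) ∧
      (boxCoord (rfl : P.d = 0 + 1) (P.L ^ 1) (fun _ => 0) x₂ i : ℝ) + (1 + ((ρ : ℝ) + 2)) ≤
        ((P.L ^ 1 * (fun _ => 3 ^ (s + 4) : Fin (0 + 1) → ℕ) i : ℕ) : ℝ) - 1 := by
    intro i
    have hb : (boxCoord (rfl : P.d = 0 + 1) (P.L ^ 1) (fun _ => 0) x₂ i : ℝ) = v + 1 := by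
      unfold boxCoord
      rw [hxv₂ (Fin.cast (rfl : P.d = 0 + 1).symm i)]
      push_cast
      ring
    rw [hb, e243, hvdef]; push_cast
    constructor <;> linarith
  -- the background `A = 0` is regular on `Ω`
  set A0 : PBond P 0 → ℝ := fun _ => 0 with hA0def
  have hreg : ∀ z ∈ Ω, ∀ (μ ν : Fin P.d),
      P.spacing 1 * |e| / e₁ * |A0 ⟨z.shift μ, ν⟩ - A0 ⟨z, ν⟩| ≤ creg * e₁ ^ (β - 1) / (3 : ℝ) ^ 1 := by
    intro z _ μ ν
    rw [hA0def, sub_self, abs_zero, mul_zero]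
    exact div_nonneg (mul_nonneg hcreg (Real.rpow_nonneg he₁.le _)) (by norm_num)
  -- §3 applied
  obtain ⟨Nc, sq, cb, hsq0, hsqN, hJ, hNle, hbound⟩ := H P rfl rfl 1 le_rfl le_rfl (by show 1 + s ≤ s + 6 + 1; omega)
    (by rw [hN, h37]; omega) Ω (bbHull_bigBlock _ _) A0 e₁ he₁ le_rfl hreg (fun _ => 0) (fun _ => 3 ^ (s + 4)) hfit hN0 (by rw [hΩdef]) 1
    (ρ + 4) le_rfl ((ρ : ℝ) + 2) 1 0 (by rw [hρdef]; push_cast; linarith) le_rfl one_pos (by push_cast; linarith)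
    (fun i => by rw [hN, e243]; push_cast; rw [show ((3 : ℝ)) ^ (s + 7) = 2187 * (3 : ℝ) ^ s by rw [pow_add]; ring]; linarith)
    x₁ x₂ hxmem₁ hdeep₁ hxmem₂ hdeep₂ (hT12.trans (by linarith))
  refine ⟨s, P, rfl, rfl, hN, c₀, e₁, hc₀, he₁, 3 ^ (s + 4), ρ + 4, (ρ : ℝ) + 2, x₁, x₂, by positivity, hne, hxmem₁, hxmem₂, ⟨w, hwout⟩,
    Nc, sq, cb, hsq0, hsqN, hJ, ?_, fun θ hθ0 hθ1 f F hF => ?_⟩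
  · simpa using hNle
  · have h := hbound θ hθ0 hθ1 f F 0 hF le_rfl (fun y _ => B5Ineq137Torus.T_nonneg P 0 x₁ y) (fun y _ => B5Ineq137Torus.T_nonneg P 0 x₂ y)
    rw [hΩdef] at h
    simpa using h

end Instance

end

end Literature.MathematicalPhysics.QuantumFieldTheory.BalabanImbrieJaffe1984to88.BIJ88LocHolder231RegularRegion
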